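import Mathlib.MeasureTheory.Function.LpSeminorm.CompareExp
import Mathlib.MeasureTheory.Function.L1Space.Integrable
import Literature.Probability.Distributions.GaussianHypercontractivity
import HarnessLib

/-!
# Gaussian hypercontractivity for polynomials: the `Lq`-norm form `‖P‖_q ≤ (q+1)^{deg/2} ‖P‖₂`

The even-moment inequality `∫ P^{2r} dγ ≤ (2r-1)^{rd} (∫ P² dγ)^r` of
`GaussianHypercontractivity.lean` (Nelson; Bonami–Gross) rewritten with Mathlib's `eLpNorm`, for
polynomials `P` of total degree `≤ d` under the standard Gaussian product measure
`γ = 𝒩(0,1)^{⊗ι}` and under Mathlib's `multivariateGaussian 0 S`: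

* `memLp_eval_pi_gaussianReal` — polynomials lie in every `L^p(γ)`, `p < ∞`;
* `eLpNorm_eval_le_of_even` — `‖P‖_{2r} ≤ (2r-1)^{d/2} ‖P‖₂` (`r ≥ 1`);
* `eLpNorm_eval_le_of_le_even` — `‖P‖_q ≤ (2r-1)^{d/2} ‖P‖₂` for `q ≤ 2r` (monotonicity of
  `L^p`-norms on a probability space);
* `eLpNorm_eval_le_sqrt_pow` — **the `q^{deg/2}` law**: `‖P‖_q ≤ (q+1)^{d/2} ‖P‖₂` for every real
  `q ≥ 2` (take `r = ⌈q/2⌉`), the form in which hypercontractivity prices the conjugate exponent in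
  Hölder estimates of renormalisation-group / constructive-field-theory arguments
  (Glimm–Jaffe §8.6; Janson 1997, Thm. 5.10 and Remark 5.11);
* `eLpNorm_multivariateGaussian_eq_pi`, `eLpNorm_eval_multivariateGaussian_le_sqrt_pow` — the same
  under `𝒩(0,S)` for any covariance matrix `S` (singular allowed).

No definitions, no named facts.

## References

* S. Janson, *Gaussian Hilbert Spaces* (1997), Thm. 5.10, Rem. 5.11. [Janson1997]
* L. Gross, *Logarithmic Sobolev inequalities*, Amer. J. Math. 97 (1975), §4. [Gross1975]
* E. Nelson, *The free Markoff field*, J. Funct. Anal. 12 (1973). [Nelson1973]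
-/

noncomputable section

namespace Literature.Probability.Distributions

open MeasureTheory ProbabilityTheory Finset MvPolynomial
open scoped ENNReal NNReal Matrix MatrixOrder

variable {ι : Type*} [Fintype ι]

/-! ### Polynomials are in every `L^p(γ)` -/

/-- Polynomials are integrable under `𝒩(0,1)^{⊗ι}` (any finite index type). [folklore] -/
theorem integrable_eval_pi_gaussianReal' (Q : MvPolynomial ι ℝ) :
    Integrable (fun x : ι → ℝ => MvPolynomial.eval x Q) (Measure.pi fun _ : ι => gaussianReal 0 1) := by
  have e : (fun x : ι → ℝ => MvPolynomial.eval x Q) =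
      fun x => ∑ α ∈ Q.support, Q.coeff α * ∏ i, x i ^ α i := by
    funext x; exact MvPolynomial.eval_eq' _ _
  rw [e]
  refine integrable_finsetSum _ fun α _ => Integrable.const_mul ?_ _
  exact Integrable.fintype_prod (f := fun i t => t ^ α i) fun i => integrable_pow_gaussianReal 0 1 (α i)

/-- Polynomials are (a.e. strongly) measurable for `γ`. [folklore] -/
theorem aestronglyMeasurable_eval_pi_gaussianReal (P : MvPolynomial ι ℝ) :
    AEStronglyMeasurable (fun x : ι → ℝ => MvPolynomial.eval x P) (Measure.pi fun _ : ι => gaussianReal 0 1) :=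
  (integrable_eval_pi_gaussianReal' P).aestronglyMeasurable

omit [Fintype ι] in
/-- `‖P(x)‖^{2r} = P(x)^{2r} = (P^{2r})(x)` pointwise, with the real exponent `(2r : ℝ≥0∞).toReal`. [folklore] -/
theorem norm_eval_rpow_two_mul (P : MvPolynomial ι ℝ) (r : ℕ) (x : ι → ℝ) :
    ‖MvPolynomial.eval x P‖ ^ ((2 * r : ℕ) : ℝ≥0∞).toReal = MvPolynomial.eval x P ^ (2 * r) := by
  rw [ENNReal.toReal_natCast, Real.rpow_natCast, Real.norm_eq_abs, Even.pow_abs ⟨r, two_mul r⟩]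

/-- Polynomials have finite even moments: `P ∈ L^{2r}(γ)`. [folklore] -/
theorem memLp_eval_pi_gaussianReal_two_mul (P : MvPolynomial ι ℝ) (r : ℕ) (hr : 1 ≤ r) :
    MemLp (fun x : ι → ℝ => MvPolynomial.eval x P) ((2 * r : ℕ) : ℝ≥0∞)
      (Measure.pi fun _ : ι => gaussianReal 0 1) := by
  have hmeas := aestronglyMeasurable_eval_pi_gaussianReal P
  rw [← integrable_norm_rpow_iff hmeas (by exact_mod_cast (show (2 * r : ℕ) ≠ 0 by omega))
    (ENNReal.natCast_ne_top _)]
  simp_rw [norm_eval_rpow_two_mul]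
  simpa only [map_pow] using integrable_eval_pi_gaussianReal' (P ^ (2 * r))

/-- **Polynomials lie in every `L^p(γ)`, `p < ∞`.** [cite: Janson1997, Thm. 3.50] -/
theorem memLp_eval_pi_gaussianReal (P : MvPolynomial ι ℝ) {p : ℝ≥0∞} (hp : p ≠ ∞) :
    MemLp (fun x : ι → ℝ => MvPolynomial.eval x P) p (Measure.pi fun _ : ι => gaussianReal 0 1) := by
  -- choose an even integer `2r ≥ p`
  obtain ⟨m, hm⟩ := exists_nat_ge p.toReal
  have h2 : p ≤ ((2 * (m + 1) : ℕ) : ℝ≥0∞) := by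
    rw [← ENNReal.ofReal_toReal hp, ← ENNReal.ofReal_natCast]
    refine ENNReal.ofReal_le_ofReal (hm.trans ?_)
    push_cast; linarith
  exact (memLp_eval_pi_gaussianReal_two_mul P (m + 1) (by omega)).mono_exponent h2

/-! ### The `Lq` form of hypercontractivity under `𝒩(0,1)^{⊗ι}` -/

/-- `‖P‖_{L^{2r}(γ)}` through the even moment: `‖P‖_{2r} = (∫ P^{2r} dγ)^{1/(2r)}`. [folklore] -/
theorem eLpNorm_eval_two_mul_eq (P : MvPolynomial ι ℝ) (r : ℕ) (hr : 1 ≤ r) :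
    eLpNorm (fun x : ι → ℝ => MvPolynomial.eval x P) ((2 * r : ℕ) : ℝ≥0∞) (Measure.pi fun _ : ι => gaussianReal 0 1) =
      ENNReal.ofReal ((∫ x, MvPolynomial.eval x P ^ (2 * r) ∂(Measure.pi fun _ : ι => gaussianReal 0 1)) ^
        ((2 * r : ℕ) : ℝ)⁻¹) := by
  rw [(memLp_eval_pi_gaussianReal_two_mul P r hr).eLpNorm_eq_integral_rpow_norm
    (by exact_mod_cast (show (2 * r : ℕ) ≠ 0 by omega)) (ENNReal.natCast_ne_top _)]
  simp_rw [norm_eval_rpow_two_mul]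
  rw [ENNReal.toReal_natCast]

/-- **Hypercontractivity, `Lq` form (even exponent)**: `‖P‖_{2r} ≤ (2r-1)^{d/2} ‖P‖₂` for `deg P ≤ d`,
`r ≥ 1`. [cite: Janson1997, Thm. 5.10] [cite: Gross1975, §4] -/
theorem eLpNorm_eval_le_of_even [DecidableEq ι] (d : ℕ) (P : MvPolynomial ι ℝ) (hP : P.totalDegree ≤ d) (r : ℕ) (hr : 1 ≤ r) :
    eLpNorm (fun x : ι → ℝ => MvPolynomial.eval x P) ((2 * r : ℕ) : ℝ≥0∞) (Measure.pi fun _ : ι => gaussianReal 0 1) ≤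
      ENNReal.ofReal (Real.sqrt (2 * r - 1) ^ d) *
        eLpNorm (fun x : ι → ℝ => MvPolynomial.eval x P) 2 (Measure.pi fun _ : ι => gaussianReal 0 1) := by
  set A := ∫ x, MvPolynomial.eval x P ^ (2 * r) ∂(Measure.pi fun _ : ι => gaussianReal 0 1) with hA
  set B := ∫ x, MvPolynomial.eval x P ^ 2 ∂(Measure.pi fun _ : ι => gaussianReal 0 1) with hB
  have hmain : A ≤ (2 * r - 1 : ℝ) ^ (r * d) * B ^ r := gaussian_bonami_pi' d P hP r hr
  have hA0 : 0 ≤ A := integral_nonneg fun x => by rw [pow_mul]; positivity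
  have hB0 : 0 ≤ B := integral_nonneg fun x => by positivity
  have hK0 : 0 ≤ Real.sqrt (2 * r - 1) ^ d := by positivity
  have h21 : (0 : ℝ) ≤ 2 * r - 1 := by
    have : (1 : ℝ) ≤ r := by exact_mod_cast hr
    linarith
  -- `(K √B)^{2r} = (2r-1)^{rd} B^r`
  have hpow : (Real.sqrt (2 * r - 1) ^ d * Real.sqrt B) ^ (2 * r) = (2 * r - 1 : ℝ) ^ (r * d) * B ^ r := by
    rw [mul_pow, ← pow_mul (Real.sqrt (2 * r - 1)) d (2 * r), show d * (2 * r) = 2 * (r * d) by ring,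
      pow_mul (Real.sqrt (2 * r - 1)) 2 (r * d), Real.sq_sqrt h21, pow_mul (Real.sqrt B) 2 r, Real.sq_sqrt hB0]
  have hroot : A ^ ((2 * r : ℕ) : ℝ)⁻¹ ≤ Real.sqrt (2 * r - 1) ^ d * Real.sqrt B := by
    have h1 : A ^ ((2 * r : ℕ) : ℝ)⁻¹ ≤
        ((Real.sqrt (2 * r - 1) ^ d * Real.sqrt B) ^ (2 * r)) ^ ((2 * r : ℕ) : ℝ)⁻¹ :=
      Real.rpow_le_rpow hA0 (hmain.trans_eq hpow.symm) (by positivity)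
    rwa [Real.pow_rpow_inv_natCast (by positivity) (by omega)] at h1
  -- the two norms
  have h2eq : eLpNorm (fun x : ι → ℝ => MvPolynomial.eval x P) 2 (Measure.pi fun _ : ι => gaussianReal 0 1) =
      ENNReal.ofReal (Real.sqrt B) := by
    have h := eLpNorm_eval_two_mul_eq P 1 le_rfl
    simp only [mul_one, Nat.cast_ofNat] at h
    rw [h, hB, Real.sqrt_eq_rpow]
    norm_num
  rw [eLpNorm_eval_two_mul_eq P r hr, h2eq, ← ENNReal.ofReal_mul hK0]
  exact ENNReal.ofReal_le_ofReal hroot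

/-- **Hypercontractivity, `Lq` form**: `‖P‖_q ≤ (2r-1)^{d/2} ‖P‖₂` whenever `q ≤ 2r` (monotonicity of
`L^p`-norms on a probability space). [cite: Janson1997, Thm. 5.10] -/
theorem eLpNorm_eval_le_of_le_even [DecidableEq ι] (d : ℕ) (P : MvPolynomial ι ℝ) (hP : P.totalDegree ≤ d) (r : ℕ) (hr : 1 ≤ r)
    {q : ℝ≥0∞} (hq : q ≤ ((2 * r : ℕ) : ℝ≥0∞)) :
    eLpNorm (fun x : ι → ℝ => MvPolynomial.eval x P) q (Measure.pi fun _ : ι => gaussianReal 0 1) ≤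
      ENNReal.ofReal (Real.sqrt (2 * r - 1) ^ d) *
        eLpNorm (fun x : ι → ℝ => MvPolynomial.eval x P) 2 (Measure.pi fun _ : ι => gaussianReal 0 1) :=
  (eLpNorm_le_eLpNorm_of_exponent_le hq (aestronglyMeasurable_eval_pi_gaussianReal P)).trans
    (eLpNorm_eval_le_of_even d P hP r hr)

/-- **The `q^{deg/2}` law**: for every real `q ≥ 2` and `deg P ≤ d`,
`‖P‖_{L^q(γ)} ≤ (q+1)^{d/2} ‖P‖_{L²(γ)}`. [cite: Janson1997, Rem. 5.11] [cite: Gross1975, §4] [cite: Nelson1973] -/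
theorem eLpNorm_eval_le_sqrt_pow [DecidableEq ι] (d : ℕ) (P : MvPolynomial ι ℝ) (hP : P.totalDegree ≤ d) {q : ℝ} (hq : 2 ≤ q) :
    eLpNorm (fun x : ι → ℝ => MvPolynomial.eval x P) (ENNReal.ofReal q) (Measure.pi fun _ : ι => gaussianReal 0 1) ≤
      ENNReal.ofReal (Real.sqrt (q + 1) ^ d) *
        eLpNorm (fun x : ι → ℝ => MvPolynomial.eval x P) 2 (Measure.pi fun _ : ι => gaussianReal 0 1) := by
  set r := ⌈q / 2⌉₊ with hr
  have hr1 : 1 ≤ r := Nat.one_le_iff_ne_zero.2 (Nat.pos_iff_ne_zero.1 (Nat.ceil_pos.2 (by linarith)))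
  have hqr : q ≤ 2 * r := by
    have := Nat.le_ceil (q / 2)
    rw [← hr] at this
    linarith
  have hr2 : (2 * r - 1 : ℝ) ≤ q + 1 := by
    have := Nat.ceil_lt_add_one (show 0 ≤ q / 2 by linarith)
    rw [← hr] at this
    linarith
  have hqE : ENNReal.ofReal q ≤ ((2 * r : ℕ) : ℝ≥0∞) := by
    rw [show ((2 * r : ℕ) : ℝ≥0∞) = ENNReal.ofReal (2 * r : ℝ) by simp]
    exact ENNReal.ofReal_le_ofReal hqr
  refine (eLpNorm_eval_le_of_le_even d P hP r hr1 hqE).trans ?_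
  exact mul_le_mul' (ENNReal.ofReal_le_ofReal
    (pow_le_pow_left₀ (Real.sqrt_nonneg _) (Real.sqrt_le_sqrt hr2) d)) le_rfl

/-! ### Under Mathlib's multivariate Gaussian `𝒩(0,S)` -/

/-- `L^p`-norms under `𝒩(0,S)` are `L^p`-norms under `𝒩(0,1)^{⊗ι}` of the pull-back along `z ↦ √S z`.
[folklore] -/
theorem eLpNorm_multivariateGaussian_eq_pi [DecidableEq ι] (S : Matrix ι ι ℝ) {F : EuclideanSpace ℝ ι → ℝ} (hF : Measurable F)
    (p : ℝ≥0∞) :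
    eLpNorm F p (multivariateGaussian 0 S) =
      eLpNorm (fun z : ι → ℝ => F (WithLp.toLp 2 (CFC.sqrt S *ᵥ z))) p (Measure.pi fun _ : ι => gaussianReal 0 1) := by
  rw [multivariateGaussian, eLpNorm_map_measure hF.aestronglyMeasurable (by fun_prop), ← map_pi_eq_stdGaussian,
    eLpNorm_map_measure (hF.comp (by fun_prop)).aestronglyMeasurable (by fun_prop)]
  congr 1
  funext z
  simp

/-- **The `q^{deg/2}` law under `𝒩(0,S)`**: for every covariance matrix `S`, real `q ≥ 2` and
`deg P ≤ d`, `‖P‖_{L^q(𝒩(0,S))} ≤ (q+1)^{d/2} ‖P‖_{L²(𝒩(0,S))}`. [cite: Janson1997, Rem. 5.11] [cite: Gross1975, §4] -/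
theorem eLpNorm_eval_multivariateGaussian_le_sqrt_pow [DecidableEq ι] (S : Matrix ι ι ℝ) (d : ℕ) (P : MvPolynomial ι ℝ)
    (hP : P.totalDegree ≤ d) {q : ℝ} (hq : 2 ≤ q) :
    eLpNorm (fun x : EuclideanSpace ℝ ι => MvPolynomial.eval (WithLp.ofLp x) P) (ENNReal.ofReal q)
        (multivariateGaussian 0 S) ≤
      ENNReal.ofReal (Real.sqrt (q + 1) ^ d) *
        eLpNorm (fun x : EuclideanSpace ℝ ι => MvPolynomial.eval (WithLp.ofLp x) P) 2 (multivariateGaussian 0 S) := by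
  have hF : Measurable fun x : EuclideanSpace ℝ ι => MvPolynomial.eval (WithLp.ofLp x) P :=
    ((MvPolynomial.continuous_eval P).comp (PiLp.continuous_ofLp 2 _)).measurable
  rw [eLpNorm_multivariateGaussian_eq_pi S hF, eLpNorm_multivariateGaussian_eq_pi S hF]
  simp only [← eval_bind₁_linSubst]
  exact eLpNorm_eval_le_sqrt_pow d _ ((totalDegree_bind₁_linSubst_le _ P).trans hP) hq

/-- **Hypercontractivity under `𝒩(0,S)`, even exponent**: `‖P‖_{2r} ≤ (2r-1)^{d/2} ‖P‖₂`. [cite: Janson1997, Thm. 5.10] -/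
theorem eLpNorm_eval_multivariateGaussian_le_of_even [DecidableEq ι] (S : Matrix ι ι ℝ) (d : ℕ) (P : MvPolynomial ι ℝ)
    (hP : P.totalDegree ≤ d) (r : ℕ) (hr : 1 ≤ r) :
    eLpNorm (fun x : EuclideanSpace ℝ ι => MvPolynomial.eval (WithLp.ofLp x) P) ((2 * r : ℕ) : ℝ≥0∞)
        (multivariateGaussian 0 S) ≤
      ENNReal.ofReal (Real.sqrt (2 * r - 1) ^ d) *
        eLpNorm (fun x : EuclideanSpace ℝ ι => MvPolynomial.eval (WithLp.ofLp x) P) 2 (multivariateGaussian 0 S) := by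
  have hF : Measurable fun x : EuclideanSpace ℝ ι => MvPolynomial.eval (WithLp.ofLp x) P :=
    ((MvPolynomial.continuous_eval P).comp (PiLp.continuous_ofLp 2 _)).measurable
  rw [eLpNorm_multivariateGaussian_eq_pi S hF, eLpNorm_multivariateGaussian_eq_pi S hF]
  simp only [← eval_bind₁_linSubst]
  exact eLpNorm_eval_le_of_even d _ ((totalDegree_bind₁_linSubst_le _ P).trans hP) r hr

end Literature.Probability.Distributions

end
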